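import Mathlib
import Summits.NavierStokesRegularity.NavierStokesRegularity.Theses.TaoLadderRungTwoBreak
import Literature.Analysis.FluidPDE.Tao2016AveragedNS.SelfSimilarCascadeBlowup
import Literature.Analysis.FluidPDE.Tao2016AveragedNS.BoundedEternalSolutions
import HarnessLib

/-!
# THE UNITARY GAP of the classification stub of K2(1) `TaoLadderRungTwoBreak.BlowupRigidityOne`
  (stmt-NavierStokesRegularity-20206): the hypothesis side of `stub_eternalIsDSS` is fed by EVERY non-trivial
  admissible DSS wave with per-shell energy ratio `μ ≥ (1+ε₀)⁻¹` — unitary (`μ = 1`, wake-free) and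
  super-unitary (`μ > 1`) waves included — while its conclusion demands a SUB-UNITARY one (`μ < 1`)

MODEL lattice ODEs only (Tao 2016 §4 (4.8) in the self-similar log-time variables of §6.4; cell vocabulary
`IsDSSWave` / `dssEmbed` / `IsEternal` / `UniformBound` / `EternalSurvivingFwd` / `Surviving` / `dssMu`); nothing
in this file is a statement about the Navier–Stokes equations, and NO item is closed by it
(`--supports stmt-NavierStokesRegularity-20206`). DEF-FREE; general `m` and general finite profile index `ρ`
except in the stub-shaped and route-shaped corollaries (`m = 4`, `ρ = Fin q`).

* `eternalSurvivingFwd_dssEmbed_of_inv_le` — the tree lemma `eternalSurvivingFwd_dssEmbed` with its hypothesis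
  `Surviving a ε₀ T` (= `(1+ε₀)^{-a} ≤ μ ∧ μ < 1`) weakened to the LOWER clause alone: the shell-wise embedding of a
  non-trivial profile family with `(1+ε₀)^{-a} ≤ μ` is forward-(S_a)-surviving, WHATEVER the size of `μ`
  (the tree proof never used `μ < 1`; recorded here as a statement);
* `boundedSurvivingEternal_of_dssWave_of_inv_le` — hence every non-trivial admissible DSS wave with
  `(1+ε₀)⁻¹ ≤ μ` (no upper clause) yields a UNIFORMLY BOUNDED admissible eternal solution surviving forward at
  `a = 1`: the hypothesis object of `stub_eternalIsDSS`, and the object excluded by K1ᵛ's inviscid slice;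
* `unitaryTransfer_of_stub_eternalIsDSS` — BY TEXT (registered signature of `stub_eternalIsDSS`, skeleton
  `9d85f4d387c689cd`, verbatim as hypothesis): the classification stub IMPLIES the «unitary-to-sub-unitary
  transfer»: below a threshold, every E₂(R) table carrying a non-trivial admissible wave with `μ ≥ (1+ε₀)⁻¹`
  (possibly `μ ≥ 1`) also carries a non-trivial (S₁)-surviving one (`(1+ε₀)⁻¹ ≤ μ < 1`). This is a consequence
  about DSS WAVES ONLY (no eternal solutions), not implied by the route Target in any visible way, and it is
  exactly the typed risk «robust blow-up driven only by waves with μ ≥ 1 … would break rigidity as typed» of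
  the item's docstring, isolated in kernel form;
* `no_dssWave_of_inv_le_of_noSurvivingEternalBdd` / `noUnitaryWave_of_noSurvivingEternalBddOne` — on the
  Liouville side the same embedding shows that `NoSurvivingEternalBdd R a` (route decl `NoSurvivingEternalBddOne`
  at `a = 1`, ⟨20451⟩, the (ρ0) child of the deciding crux) forbids, below its threshold, EVERY non-trivial
  admissible DSS wave with `(1+ε₀)^{-a} ≤ μ` — in particular the WAKE-FREE (`μ = 1`) solitary front named in
  the route text as its would-be refuter — sharpening the tree's `noSurvivingDSS_of_noSurvivingEternalBdd`
  (which speaks of `μ < 1` waves only).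

HONEST LABEL: bookkeeping of a typed gap; whether a unitary or super-unitary admissible wave exists on any
comparable table is OPEN (none is known); no stub, crux or summit is proved; rung 0.
-/

noncomputable section

-- the summit and its single sub-problem share the name (CONVENTIONS §1)
set_option linter.dupNamespace false

open Set Filter Topology MeasureTheory

namespace Summit.NavierStokesRegularity.NavierStokesRegularity.Theorems

namespace BlowupRigidityOne

open Literature.Analysis.FluidPDE Literature.Analysis.FluidPDE.TaoCascade

variable {m : ℕ} {ρ : Type*} [Fintype ρ]

/-- **Forward survival of the embedding from the LOWER survival clause alone.** If `T > 0`,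
`(1+ε₀)^{-a} ≤ μ = e^{2T}/(1+ε₀)^5` (NO upper clause `μ < 1`) and the profile family is non-trivial, the
shell-wise embedding `dssEmbed π T Φ r₀` is forward-(S_a)-surviving: along the shells `n = N'·|π|` the family
revisits the profile `r₀` at log-time `nT + x₀` with the `a`-weighted energy multiplied by `((1+ε₀)^a μ)^n ≥ 1`.
(Proof = the tree's `eternalSurvivingFwd_dssEmbed` with `hS.1` in place of `hS`.)
[cite: Tao2016AveragedNS, §4 Lemma 4.1 (4.8)–(4.10) in self-similar variables, §6.4; cell vocabulary (`dssEmbed`, `physWeight`, `dssMu`)] -/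
theorem eternalSurvivingFwd_dssEmbed_of_inv_le {ε₀ a : ℝ} {π : Equiv.Perm ρ} {T : ℝ}
    {Φ : ρ → ℝ → Em m} (hε : 0 < ε₀) (hT : 0 < T) (hμ : (1 + ε₀) ^ (-a) ≤ dssMu ε₀ T)
    {r₀ : ρ} {x₀ : ℝ} (hne : Φ r₀ x₀ ≠ 0) : EternalSurvivingFwd a ε₀ (dssEmbed π T Φ r₀) := by
  classical
  have hb : 0 < 1 + ε₀ := by linarith
  -- the survival factor per shell: physWeight · e^{2T} = (1+ε₀)^a · μ ≥ 1
  have hq : 1 ≤ physWeight a ε₀ * Real.exp (2 * T) := by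
    have hpos : 0 < (1 + ε₀) ^ a := Real.rpow_pos_of_pos hb a
    have hneg : (1 + ε₀) ^ (-a) = ((1 + ε₀) ^ a)⁻¹ := Real.rpow_neg hb.le a
    have h1 : 1 ≤ (1 + ε₀) ^ a * dssMu ε₀ T := by
      rw [hneg] at hμ
      have := mul_le_mul_of_nonneg_left hμ hpos.le
      rwa [mul_inv_cancel₀ hpos.ne'] at this
    calc (1 : ℝ) ≤ (1 + ε₀) ^ a * dssMu ε₀ T := h1
      _ = physWeight a ε₀ * Real.exp (2 * T) := by unfold dssMu physWeight; ring
  refine ⟨Real.exp (2 * x₀) * ‖Φ r₀ x₀‖ ^ 2, ?_, fun N => ?_⟩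
  · exact mul_pos (Real.exp_pos _) (by positivity)
  -- push the revisit index forward until the log-time `kT + x₀` passes `N`
  obtain ⟨M, hM⟩ : ∃ M : ℕ, ((N : ℝ) - x₀) / T ≤ M := exists_nat_ge _
  refine ⟨max N M * orderOf π, ?_, (max N M * orderOf π : ℕ) * T + x₀, ?_, ?_⟩
  · exact (le_max_left N M).trans (Nat.le_mul_of_pos_right _ (orderOf_pos π))
  · have h1 : ((max N M : ℕ) : ℝ) ≤ ((max N M * orderOf π : ℕ) : ℝ) := by
      exact_mod_cast Nat.le_mul_of_pos_right _ (orderOf_pos π)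
    have h2 : (M : ℝ) ≤ ((max N M : ℕ) : ℝ) := by exact_mod_cast le_max_right N M
    have h3 : ((N : ℝ) - x₀) / T ≤ ((max N M : ℕ) : ℝ) := hM.trans h2
    have h4 : (N : ℝ) - x₀ ≤ ((max N M : ℕ) : ℝ) * T := by rwa [div_le_iff₀ hT] at h3
    have h5 : ((max N M : ℕ) : ℝ) * T ≤ ((max N M * orderOf π : ℕ) : ℝ) * T :=
      mul_le_mul_of_nonneg_right h1 hT.le
    linarith
  have hret : dssEmbed π T Φ r₀ ((max N M * orderOf π : ℕ) : ℤ)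
      ((max N M * orderOf π : ℕ) * T + x₀) = Φ r₀ x₀ := by
    simp only [dssEmbed, perm_zpow_mul_orderOf_apply, Int.cast_natCast]; ring_nf
  rw [hret]
  set k : ℕ := max N M * orderOf π with hk
  have hexp : Real.exp (2 * ((k : ℝ) * T + x₀)) = Real.exp (2 * T) ^ k * Real.exp (2 * x₀) := by
    rw [← Real.exp_nat_mul, ← Real.exp_add]; ring_nf
  rw [hexp]
  have hw : 0 ≤ physWeight a ε₀ := by unfold physWeight; positivity
  calc Real.exp (2 * x₀) * ‖Φ r₀ x₀‖ ^ 2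
      = 1 * (Real.exp (2 * x₀) * ‖Φ r₀ x₀‖ ^ 2) := (one_mul _).symm
    _ ≤ (physWeight a ε₀ * Real.exp (2 * T)) ^ k * (Real.exp (2 * x₀) * ‖Φ r₀ x₀‖ ^ 2) :=
        mul_le_mul_of_nonneg_right (one_le_pow₀ hq) (by positivity)
    _ = physWeight a ε₀ ^ k * (Real.exp (2 * T) ^ k * Real.exp (2 * x₀) * ‖Φ r₀ x₀‖ ^ 2) := by
        rw [mul_pow]; ring

/-- **Every non-trivial admissible DSS wave with `(1+ε₀)^{-a} ≤ μ` — unitary and super-unitary waves included —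
carries a uniformly bounded admissible eternal solution surviving forward at exponent `a`** (the wave's own
shell-wise embedding): the hypothesis object of the classification stub `stub_eternalIsDSS` (at `a = 1`), and
the object excluded by the bounded inviscid Liouville predicate `NoSurvivingEternalBdd R a`.
[cite: Tao2016AveragedNS, §4 Lemma 4.1 (4.8) in self-similar variables, §6.4; cell vocabulary (`IsDSSWave`, `IsEternal`, `UniformBound`, `EternalSurvivingFwd`)] -/
theorem boundedSurvivingEternal_of_dssWave_of_inv_le {ε₀ a : ℝ} (hε : 0 < ε₀)
    {α : Fin m → Fin m → Fin m → ℤ × ℤ × ℤ → ℝ} {π : Equiv.Perm ρ} {T : ℝ} {Φ : ρ → ℝ → Em m}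
    (hW : IsDSSWave ε₀ α π T Φ) (hμ : (1 + ε₀) ^ (-a) ≤ dssMu ε₀ T) {r₀ : ρ} {x₀ : ℝ}
    (hne : Φ r₀ x₀ ≠ 0) :
    ∃ W : ℤ → ℝ → Em m, IsEternal ε₀ α W ∧ UniformBound W ∧ EternalSurvivingFwd a ε₀ W :=
  ⟨dssEmbed π T Φ r₀, hW.isEternal_dssEmbed r₀, uniformBound_dssEmbed hW r₀,
    eternalSurvivingFwd_dssEmbed_of_inv_le hε hW.delay_pos hμ hne⟩

/-- **The unitary-to-sub-unitary transfer forced by the classification stub.** BY TEXT: the REGISTERED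
signature of `stub_eternalIsDSS` (skeleton `9d85f4d387c689cd` of K2(1) `BlowupRigidityOne`, verbatim, as
hypothesis) implies that below a threshold every table of E₂(R) carrying a non-trivial admissible DSS wave with
per-shell energy ratio `μ ≥ (1+ε₀)⁻¹` — NO upper clause, so a unitary (`μ = 1`, wake-free) or super-unitary
(`μ > 1`) wave qualifies — also carries a non-trivial (S₁)-SURVIVING admissible wave (`(1+ε₀)⁻¹ ≤ μ < 1`).
The converse bookkeeping (a surviving wave trivially has `μ ≥ (1+ε₀)⁻¹`) is vacuous; the content is the
typed gap `μ < 1` of the stub's conclusion against its hypothesis.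
[cite: Tao2016AveragedNS, §4 Lemma 4.1 (4.8), §6.4; cell vocabulary (`IsDSSWave`, `Surviving`, `dssMu`)] -/
theorem unitaryTransfer_of_stub_eternalIsDSS
    (hcl : ∀ R : ℝ, 1 ≤ R → ∃ εs : ℝ, 0 < εs ∧ ∀ ε₀ : ℝ, 0 < ε₀ → ε₀ ≤ εs →
      ∀ α : (Fin 4 → Fin 4 → Fin 4 → ℤ × ℤ × ℤ → ℝ),
        Literature.Analysis.FluidPDE.TaoCascade.InTableClass R α →
        (∃ W : ℤ → ℝ → Literature.Analysis.FluidPDE.TaoCascade.Em 4,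
          Literature.Analysis.FluidPDE.TaoCascade.IsEternal ε₀ α W ∧
          Literature.Analysis.FluidPDE.TaoCascade.EternalSurvivingFwd 1 ε₀ W) →
        ∃ (q : ℕ) (π : Equiv.Perm (Fin q)) (T : ℝ)
          (Φ : Fin q → ℝ → Literature.Analysis.FluidPDE.TaoCascade.Em 4),
          Literature.Analysis.FluidPDE.TaoCascade.IsDSSWave ε₀ α π T Φ ∧
          Literature.Analysis.FluidPDE.TaoCascade.Surviving 1 ε₀ T ∧ ∃ r x, Φ r x ≠ 0) :
    ∀ R : ℝ, 1 ≤ R → ∃ εs : ℝ, 0 < εs ∧ ∀ ε₀ : ℝ, 0 < ε₀ → ε₀ ≤ εs →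
      ∀ α : (Fin 4 → Fin 4 → Fin 4 → ℤ × ℤ × ℤ → ℝ), InTableClass R α →
        (∃ (q : ℕ) (π : Equiv.Perm (Fin q)) (T : ℝ) (Φ : Fin q → ℝ → Em 4),
          IsDSSWave ε₀ α π T Φ ∧ (1 + ε₀) ^ (-(1 : ℝ)) ≤ dssMu ε₀ T ∧ ∃ r x, Φ r x ≠ 0) →
        ∃ (q : ℕ) (π : Equiv.Perm (Fin q)) (T : ℝ) (Φ : Fin q → ℝ → Em 4),
          IsDSSWave ε₀ α π T Φ ∧ Surviving 1 ε₀ T ∧ ∃ r x, Φ r x ≠ 0 := by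
  intro R hR
  obtain ⟨εs, hεs, H⟩ := hcl R hR
  refine ⟨εs, hεs, fun ε₀ hε₀ hle α hα hwave => ?_⟩
  obtain ⟨q, π, T, Φ, hW, hμ, r₀, x₀, hne⟩ := hwave
  obtain ⟨W, hWE, -, hWS⟩ := boundedSurvivingEternal_of_dssWave_of_inv_le hε₀ hW hμ hne
  exact H ε₀ hε₀ hle α hα ⟨W, hWE, hWS⟩

/-- **The bounded inviscid Liouville predicate forbids unitary and super-unitary waves too.**
`NoSurvivingEternalBdd R a` excludes, below its threshold, EVERY non-trivial admissible DSS wave of an E₂(R)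
table whose per-shell energy ratio satisfies the LOWER clause `(1+ε₀)^{-a} ≤ μ` only — in particular a
WAKE-FREE (`μ = 1`) solitary front — sharpening the tree's `noSurvivingDSS_of_noSurvivingEternalBdd`
(which concludes about `μ < 1` waves).
[cite: Tao2016AveragedNS, §4 Thm. 4.2 (statement shape), Lemma 4.1 (4.8), §6.4; cell vocabulary (`NoSurvivingEternalBdd`, `IsDSSWave`, `dssMu`)] -/
theorem no_dssWave_of_inv_le_of_noSurvivingEternalBdd {R a : ℝ} (h : NoSurvivingEternalBdd R a) :
    ∃ εs : ℝ, 0 < εs ∧ ∀ ε₀ : ℝ, 0 < ε₀ → ε₀ ≤ εs →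
      ∀ α : (Fin 4 → Fin 4 → Fin 4 → ℤ × ℤ × ℤ → ℝ), InTableClass R α →
        ∀ (q : ℕ) (π : Equiv.Perm (Fin q)) (T : ℝ) (Φ : Fin q → ℝ → Em 4),
          IsDSSWave ε₀ α π T Φ → (1 + ε₀) ^ (-a) ≤ dssMu ε₀ T → ∀ r x, Φ r x = 0 := by
  obtain ⟨εs, hεs, H⟩ := h
  refine ⟨εs, hεs, fun ε₀ hε₀ hle α hα q π T Φ hW hμ r x => ?_⟩
  by_contra hne
  obtain ⟨W, hWE, hWU, hWS⟩ := boundedSurvivingEternal_of_dssWave_of_inv_le hε₀ hW hμ hne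
  exact H ε₀ hε₀ hle α hα W hWE hWU hWS

/-- **BY NAME, Liouville side:** the route decl `NoSurvivingEternalBddOne` ((ρ0), ⟨20451⟩, child of the
deciding crux `NoSurvivingEternalViscBddOne`) forbids, for every spread `R ≥ 1` and below its threshold, every
non-trivial admissible DSS wave of an E₂(R) table with `(1+ε₀)⁻¹ ≤ μ` — unitary (wake-free) and super-unitary
waves included; the would-be refuter «wake-free lattice solitary wave» of the route text is thus ALREADY inside
what (ρ0) denies, with no sub-unitarity proviso.
[cite: Tao2016AveragedNS, §4 Thm. 4.2 (statement shape), §6.4; cell vocabulary] -/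
theorem noUnitaryWave_of_noSurvivingEternalBddOne
    (h : Summit.NavierStokesRegularity.NavierStokesRegularity.Theses.TaoLadderRungTwoBreak.NoSurvivingEternalBddOne) :
    ∀ R : ℝ, 1 ≤ R → ∃ εs : ℝ, 0 < εs ∧ ∀ ε₀ : ℝ, 0 < ε₀ → ε₀ ≤ εs →
      ∀ α : (Fin 4 → Fin 4 → Fin 4 → ℤ × ℤ × ℤ → ℝ), InTableClass R α →
        ∀ (q : ℕ) (π : Equiv.Perm (Fin q)) (T : ℝ) (Φ : Fin q → ℝ → Em 4),
          IsDSSWave ε₀ α π T Φ → (1 + ε₀) ^ (-(1 : ℝ)) ≤ dssMu ε₀ T → ∀ r x, Φ r x = 0 :=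
  fun R hR => no_dssWave_of_inv_le_of_noSurvivingEternalBdd (h R hR)

end BlowupRigidityOne

end Summit.NavierStokesRegularity.NavierStokesRegularity.Theorems

end
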